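import Summits.BirchSwinnertonDyer.BirchSwinnertonDyer.Theorems.BiquadraticEisensteinDescentManinDatumSupercuspidalCMInertFormalChord
import Literature.NumberTheory.EllipticCurves.ComplexTorusAddProofs
import Literature.NumberTheory.EllipticCurves.EisensteinValuesAtI
import Summits.BirchSwinnertonDyer.BirchSwinnertonDyer.Theorems.InertBadSignedBranchesInertBadAtThreeQuarticCleanAssemblyCRT
import Mathlib.NumberTheory.Zsqrtd.GaussianInt
import HarnessLib

set_option linter.dupNamespace false -- `Summit.BirchSwinnertonDyer.BirchSwinnertonDyer.Theorems.…` (summit = sub, D-0017)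
set_option autoImplicit false

/-!
# Crux `ManinDatumSupercuspidalCMInert` (stmt-BirchSwinnertonDyer-20111, BED r605), CM side of H₇ — step (d) of memo PLAIN-ODD-57,
# second brick (a): the `7`-division points `P_c = (X(c/7), Y(c/7))` (`c ∈ ℤ[i]`) of `y² = x³ − x` — lattice bookkeeping, the CM
# action `[i]`, valuations of `X_c, Y_c, t_c = X_c/Y_c`

Route `BiquadraticEisensteinDescent` (cell `pub/bsd-wall`, width seat `bsd-wall-cm-bed-w4` g11, RESOLVENT LANE; `--supports`
stmt-BirchSwinnertonDyer-20111, helper). THEOREMS ONLY (no definition, no named fact, no `sorry`); nothing is closed by this file and BSD is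
not proved by any of it.

For `c ∈ ℤ[i]` write `X_c = ℘(c/7)/ϖ₀²`, `Y_c = ℘′(c/7)/(2ϖ₀³)`, `t_c = X_c/Y_c` (`℘` of `Λ = ℤi + ℤ`, `ϖ₀ = Γ(1/4)²/(2√(2π))`; `Y² = X³ − X`).
* §1 `induction_mod_seven` — a predicate on `ℤ[i] ∖ 7ℤ[i]` that holds at `1` and is stable under `u ↦ iu`, `u ↦ −u`, `u ≡ u′ (7)` and
  GENERIC sums (`u, u′, u ± u′, 2u + u′, u + 2u′ ∉ 7ℤ[i]`) holds everywhere (the chain `1, i, 1 ± i, 2, 3, −3 ≡ 4, …, a + bi`);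
* §2 the division values: `c/7 ∈ Λ ↔ 7 ∣ c`, `7`-periodicity, `X_{ic} = −X_c`, `Y_{ic} = iY_c`, `t_{ic} = i t_c`, `X_{−c} = X_c`,
  `Y_{−c} = −Y_c`; `X_c = X_d ↔ c ≡ ±d`; for every valuation `v` of `ℂ` with `v 7 < 1`: `v(t_c) = v(t_1) =: r`, `r⁴⁸ = v 7`,
  `v(X_c⁻¹) = r²`, `v(Y_c⁻¹) = r³` (bed-w4 g10 `val_weierstrassP_seven_div`), and `t_c = t_d → c ≡ d`;
The sequel `…SevenDivisionTameCharacter` draws the consequence `v(t_u − u·t_1) < v(t_1)` (the tame character of `ℚ(i)(E₀[7])/ℚ(i)` is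
the CM character), the Galois input (d) of `…TameResolvent.resolvent_valuation_le` (design note
`Cruxes/ManinDatumSupercuspidalCMInert/MODEL-ASSEMBLY-LANES-w2g10.md`, X-FORMAL route).

References: [SilvermanAEC2009] IV.1 (formal group law `z₃ = z₁ + z₂ + …`), III.2.3, VII.3; [Serre1979] Ch. IV §2 Prop. 7 (tame character);
[SilvermanATAEC1994] II.1–II.2 (CM action on torsion).
-/

noncomputable section

open Complex PeriodPair
open scoped PeriodPair
open Literature.NumberTheory.EllipticCurves Literature.NumberTheory.EllipticCurves.GaussianLattice

namespace Summit.BirchSwinnertonDyer.BirchSwinnertonDyer.Theorems.BiquadraticEisensteinDescentManinDatumSupercuspidalCMInertSevenDivisionPoints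

open Summit.BirchSwinnertonDyer.BirchSwinnertonDyer.Theorems.BiquadraticEisensteinDescentManinDatumSupercuspidalCMInertSevenDivisionEisenstein
  (val_weierstrassP_seven_div psi_seven_weierstrassP_div val_intCast_le_one)
open Summit.BirchSwinnertonDyer.BirchSwinnertonDyer.Theorems.InertBadSignedBranchesInertBadAtThreeQuarticCleanAssembly (toComplex_mem_lattice)
open Summit.BirchSwinnertonDyer.BirchSwinnertonDyer.Theorems.BiquadraticEisensteinDescentManinDatumSupercuspidalCMInertFormalChord
  (normalizedX_add)

/-! ## §1 Arithmetic of `ℤ[i]` modulo `7` and the generic-sum induction -/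

section GaussMod

/-- `7 ∣ x + yi` in `ℤ[i]` iff `7 ∣ x` and `7 ∣ y`. [folklore] -/
theorem seven_dvd_mk_iff (x y : ℤ) : (7 : GaussianInt) ∣ (⟨x, y⟩ : GaussianInt) ↔ (7 : ℤ) ∣ x ∧ (7 : ℤ) ∣ y := by
  rw [show (7 : GaussianInt) = ((7 : ℤ) : GaussianInt) by rfl]
  exact Zsqrtd.intCast_dvd 7 _

/-- `7 ∣ u` iff `7 ∣ re u` and `7 ∣ im u`. [folklore] -/
theorem seven_dvd_iff (u : GaussianInt) : (7 : GaussianInt) ∣ u ↔ (7 : ℤ) ∣ u.re ∧ (7 : ℤ) ∣ u.im := by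
  rw [show (7 : GaussianInt) = ((7 : ℤ) : GaussianInt) by rfl]
  exact Zsqrtd.intCast_dvd 7 _

/-- **Induction modulo `7` along generic sums.** A predicate `P` on `ℤ[i] ∖ 7ℤ[i]` which holds at `1`, is stable under `u ↦ iu`,
`u ↦ −u`, under `u ≡ u′ (mod 7)`, and under GENERIC sums `u + u′` (`u, u′, u + u′, u − u′, 2u + u′, u + 2u′ ∉ 7ℤ[i]`), holds on all of
`ℤ[i] ∖ 7ℤ[i]` (chain `1, ±i, 1 ± i, 2 = (1+i) + (1−i), 3 = 2 + 1, 4 ≡ −3, 5 ≡ −2, 6 ≡ −1, bi, a + bi`). [folklore] -/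
theorem induction_mod_seven {P : GaussianInt → Prop} (h1 : P 1)
    (hI : ∀ u, ¬ (7 : GaussianInt) ∣ u → P u → P (⟨0, 1⟩ * u))
    (hneg : ∀ u, ¬ (7 : GaussianInt) ∣ u → P u → P (-u))
    (hmod : ∀ u u', ¬ (7 : GaussianInt) ∣ u → (7 : GaussianInt) ∣ u' - u → P u → P u')
    (hadd : ∀ u u', ¬ (7 : GaussianInt) ∣ u → ¬ (7 : GaussianInt) ∣ u' → ¬ (7 : GaussianInt) ∣ u + u' →
      ¬ (7 : GaussianInt) ∣ u - u' → ¬ (7 : GaussianInt) ∣ 2 * u + u' → ¬ (7 : GaussianInt) ∣ u + 2 * u' →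
      P u → P u' → P (u + u'))
    (u : GaussianInt) (hu : ¬ (7 : GaussianInt) ∣ u) : P u := by
  -- a uniform discharger of the divisibility side conditions on explicit Gaussian integers
  have nd : ∀ x y : ℤ, ¬ ((7 : ℤ) ∣ x ∧ (7 : ℤ) ∣ y) → ¬ (7 : GaussianInt) ∣ (⟨x, y⟩ : GaussianInt) :=
    fun x y h h' ↦ h ((seven_dvd_mk_iff x y).mp h')
  -- explicit forms
  have mkI : ∀ x y : ℤ, (⟨0, 1⟩ : GaussianInt) * ⟨x, y⟩ = ⟨-y, x⟩ := fun x y ↦ by ext <;> simp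
  have mkneg : ∀ x y : ℤ, -(⟨x, y⟩ : GaussianInt) = ⟨-x, -y⟩ := fun x y ↦ by ext <;> simp
  have mkadd : ∀ x y x' y' : ℤ, (⟨x, y⟩ : GaussianInt) + ⟨x', y'⟩ = ⟨x + x', y + y'⟩ := fun x y x' y' ↦ by ext <;> simp
  have mksub : ∀ x y x' y' : ℤ, (⟨x, y⟩ : GaussianInt) - ⟨x', y'⟩ = ⟨x - x', y - y'⟩ := fun x y x' y' ↦ by ext <;> simp
  have mktwo : ∀ x y : ℤ, (2 : GaussianInt) * ⟨x, y⟩ = ⟨2 * x, 2 * y⟩ := fun x y ↦ by ext <;> simp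
  have one_eq : (1 : GaussianInt) = ⟨1, 0⟩ := rfl
  -- generic addition on explicit pairs
  have hadd' : ∀ x y x' y' : ℤ, ¬ ((7 : ℤ) ∣ x ∧ (7 : ℤ) ∣ y) → ¬ ((7 : ℤ) ∣ x' ∧ (7 : ℤ) ∣ y') →
      ¬ ((7 : ℤ) ∣ x + x' ∧ (7 : ℤ) ∣ y + y') → ¬ ((7 : ℤ) ∣ x - x' ∧ (7 : ℤ) ∣ y - y') →
      ¬ ((7 : ℤ) ∣ 2 * x + x' ∧ (7 : ℤ) ∣ 2 * y + y') → ¬ ((7 : ℤ) ∣ x + 2 * x' ∧ (7 : ℤ) ∣ y + 2 * y') →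
      P ⟨x, y⟩ → P ⟨x', y'⟩ → P ⟨x + x', y + y'⟩ := by
    intro x y x' y' h h' hs hd h2 h2' hP hP'
    rw [← mkadd]
    refine hadd _ _ (nd _ _ h) (nd _ _ h') ?_ ?_ ?_ ?_ hP hP'
    · rw [mkadd]; exact nd _ _ hs
    · rw [mksub]; exact nd _ _ hd
    · rw [mktwo, mkadd]; exact nd _ _ h2
    · rw [mktwo, mkadd]; exact nd _ _ h2'
  have hI' : ∀ x y : ℤ, ¬ ((7 : ℤ) ∣ x ∧ (7 : ℤ) ∣ y) → P ⟨x, y⟩ → P ⟨-y, x⟩ :=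
    fun x y h hP ↦ by rw [← mkI]; exact hI _ (nd _ _ h) hP
  have hneg' : ∀ x y : ℤ, ¬ ((7 : ℤ) ∣ x ∧ (7 : ℤ) ∣ y) → P ⟨x, y⟩ → P ⟨-x, -y⟩ :=
    fun x y h hP ↦ by rw [← mkneg]; exact hneg _ (nd _ _ h) hP
  have hmod' : ∀ x y x' y' : ℤ, ¬ ((7 : ℤ) ∣ x ∧ (7 : ℤ) ∣ y) → ((7 : ℤ) ∣ x' - x ∧ (7 : ℤ) ∣ y' - y) →
      P ⟨x, y⟩ → P ⟨x', y'⟩ :=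
    fun x y x' y' h h' hP ↦ hmod _ _ (nd _ _ h) (by rw [mksub]; exact (seven_dvd_mk_iff _ _).mpr h') hP
  -- the chain through the reals `1, …, 6`
  have p1 : P ⟨1, 0⟩ := one_eq ▸ h1
  have pi : P ⟨0, 1⟩ := by simpa using hI' 1 0 (by omega) p1
  have pmi : P ⟨0, -1⟩ := by simpa using hneg' 0 1 (by omega) pi
  have p1i : P ⟨1, 1⟩ := by simpa using hadd' 1 0 0 1 (by omega) (by omega) (by omega) (by omega) (by omega) (by omega) p1 pi
  have p1mi : P ⟨1, -1⟩ := by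
    simpa using hadd' 1 0 0 (-1) (by omega) (by omega) (by omega) (by omega) (by omega) (by omega) p1 pmi
  have p2 : P ⟨2, 0⟩ := by
    simpa using hadd' 1 1 1 (-1) (by omega) (by omega) (by omega) (by omega) (by omega) (by omega) p1i p1mi
  have p3 : P ⟨3, 0⟩ := by
    simpa using hadd' 2 0 1 0 (by omega) (by omega) (by omega) (by omega) (by omega) (by omega) p2 p1
  have p4 : P ⟨4, 0⟩ := hmod' (-3) 0 4 0 (by omega) (by omega) (by simpa using hneg' 3 0 (by omega) p3)
  have p5 : P ⟨5, 0⟩ := hmod' (-2) 0 5 0 (by omega) (by omega) (by simpa using hneg' 2 0 (by omega) p2)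
  have p6 : P ⟨6, 0⟩ := hmod' (-1) 0 6 0 (by omega) (by omega) (by simpa using hneg' 1 0 (by omega) p1)
  have preal : ∀ a : ℤ, 1 ≤ a → a ≤ 6 → P ⟨a, 0⟩ := by
    intro a ha ha'
    interval_cases a
    exacts [p1, p2, p3, p4, p5, p6]
  have pimag : ∀ b : ℤ, 1 ≤ b → b ≤ 6 → P ⟨0, b⟩ := fun b hb hb' ↦ by
    simpa using hI' b 0 (by omega) (preal b hb hb')
  have pab : ∀ a b : ℤ, 0 ≤ a → a ≤ 6 → 0 ≤ b → b ≤ 6 → ¬ (a = 0 ∧ b = 0) → P ⟨a, b⟩ := by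
    intro a b ha ha' hb hb' hab
    rcases eq_or_lt_of_le ha with rfl | ha1
    · exact pimag b (by omega) hb'
    rcases eq_or_lt_of_le hb with rfl | hb1
    · exact preal a (by omega) ha'
    simpa using hadd' a 0 0 b (by omega) (by omega) (by omega) (by omega) (by omega) (by omega)
      (preal a (by omega) ha') (pimag b (by omega) hb')
  -- reduce `u` modulo `7`
  have hu' : ¬ ((7 : ℤ) ∣ u.re ∧ (7 : ℤ) ∣ u.im) := fun h ↦ hu ((seven_dvd_iff u).mpr h)
  have key := pab (u.re % 7) (u.im % 7) (Int.emod_nonneg _ (by norm_num)) (by omega)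
    (Int.emod_nonneg _ (by norm_num)) (by omega) (by omega)
  refine hmod _ _ (nd _ _ (by omega)) ?_ key
  rw [seven_dvd_iff]
  simp only [Zsqrtd.re_sub, Zsqrtd.im_sub]
  omega

end GaussMod

/-! ## §2 The `7`-division values `X_c`, `Y_c`, `t_c = X_c / Y_c` -/

section DivisionValues

/-- `ϖ₀ ≠ 0` in `ℂ`. [folklore] -/
theorem varpi_ne_zero' : ((Real.Gamma (1 / 4) ^ 2 / (2 * Real.sqrt (2 * Real.pi)) : ℝ) : ℂ) ≠ 0 := Complex.ofReal_ne_zero.mpr varpi_pos.ne'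

/-- **`c/7 ∈ ℤi + ℤ ↔ 7 ∣ c` in `ℤ[i]`.** [folklore] -/
theorem div_seven_mem_lattice_iff (c : GaussianInt) :
    ((c : GaussianInt) : ℂ) / 7 ∈ (ofUpperHalfPlane UpperHalfPlane.I).lattice ↔ (7 : GaussianInt) ∣ c := by
  constructor
  · intro h
    obtain ⟨m, n, hmn⟩ := mem_lattice_iff.mp h
    have hc : ((c : GaussianInt) : ℂ) = (((7 * ⟨n, m⟩ : GaussianInt)) : ℂ) := by
      have h7 := congrArg (fun z : ℂ ↦ 7 * z) hmn
      simp only [mul_div_cancel₀ _ (by norm_num : (7 : ℂ) ≠ 0)] at h7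
      rw [← h7, map_mul, map_ofNat, GaussianInt.toComplex_def' n m]
      ring
    exact ⟨⟨n, m⟩, GaussianInt.toComplex_injective hc⟩
  · rintro ⟨d, rfl⟩
    rw [show (((7 * d : GaussianInt)) : ℂ) / 7 = ((d : GaussianInt) : ℂ) by rw [map_mul, map_ofNat]; ring]
    exact toComplex_mem_lattice d

/-- `c/7 ∉ ℤi + ℤ` for `7 ∤ c`. [folklore] -/
theorem div_seven_notMem {c : GaussianInt} (hc : ¬ (7 : GaussianInt) ∣ c) :
    ((c : GaussianInt) : ℂ) / 7 ∉ (ofUpperHalfPlane UpperHalfPlane.I).lattice := fun h ↦ hc ((div_seven_mem_lattice_iff c).mp h)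

/-- `7 · (c/7) ∈ ℤi + ℤ`. [folklore] -/
theorem seven_mul_div_seven_mem (c : GaussianInt) : (7 : ℂ) * (((c : GaussianInt) : ℂ) / 7) ∈ (ofUpperHalfPlane UpperHalfPlane.I).lattice := by
  rw [mul_div_cancel₀ _ (by norm_num : (7 : ℂ) ≠ 0)]; exact toComplex_mem_lattice c

/-- **`7`-periodicity**: `X_{c′} = X_c` and `Y_{c′} = Y_c` for `c′ ≡ c (mod 7)`. [folklore] -/
theorem X_Y_eq_of_dvd_sub {c c' : GaussianInt} (h : (7 : GaussianInt) ∣ c' - c) :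
    (℘[ofUpperHalfPlane UpperHalfPlane.I] (((c' : GaussianInt) : ℂ) / 7) / ((Real.Gamma (1 / 4) ^ 2 / (2 * Real.sqrt (2 * Real.pi)) : ℝ) : ℂ) ^ 2) =
        (℘[ofUpperHalfPlane UpperHalfPlane.I] (((c : GaussianInt) : ℂ) / 7) / ((Real.Gamma (1 / 4) ^ 2 / (2 * Real.sqrt (2 * Real.pi)) : ℝ) : ℂ) ^ 2) ∧
        (℘'[ofUpperHalfPlane UpperHalfPlane.I] (((c' : GaussianInt) : ℂ) / 7) / (2 * ((Real.Gamma (1 / 4) ^ 2 / (2 * Real.sqrt (2 * Real.pi)) : ℝ) : ℂ) ^ 3)) =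
        (℘'[ofUpperHalfPlane UpperHalfPlane.I] (((c : GaussianInt) : ℂ) / 7) / (2 * ((Real.Gamma (1 / 4) ^ 2 / (2 * Real.sqrt (2 * Real.pi)) : ℝ) : ℂ) ^ 3)) := by
  obtain ⟨d, hd⟩ := h
  have hc' : ((c' : GaussianInt) : ℂ) / 7 = ((c : GaussianInt) : ℂ) / 7 + ((d : GaussianInt) : ℂ) := by
    have : (c' : GaussianInt) = c + 7 * d := by rw [← hd]; ring
    rw [this, map_add, map_mul, map_ofNat]; ring
  rw [hc', show ((d : GaussianInt) : ℂ) = ((⟨_, toComplex_mem_lattice d⟩ : (ofUpperHalfPlane UpperHalfPlane.I).lattice) : ℂ) from rfl,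
    PeriodPair.weierstrassP_add_coe, PeriodPair.derivWeierstrassP_add_coe]
  exact ⟨rfl, rfl⟩

/-- `((0,1)·c : ℂ) = i·c`. [folklore] -/
theorem toComplex_I_mul (c : GaussianInt) : (((⟨0, 1⟩ * c : GaussianInt)) : ℂ) = I * ((c : GaussianInt) : ℂ) := by
  rw [GaussianInt.toComplex_mul, GaussianInt.toComplex_def' 0 1]; simp

/-- **The CM action `[i]`**: `X_{ic} = −X_c`, `Y_{ic} = i·Y_c` (`℘(iz) = −℘(z)`, `℘′(iz) = i℘′(z)` on `ℤi + ℤ`).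
[cite: SilvermanATAEC1994, II.2 (Example 2.3.1: `[i](x,y) = (−x, iy)`)] -/
theorem X_Y_I_mul (c : GaussianInt) :
    (℘[ofUpperHalfPlane UpperHalfPlane.I] ((((⟨0, 1⟩ * c) : GaussianInt) : ℂ) / 7) / ((Real.Gamma (1 / 4) ^ 2 / (2 * Real.sqrt (2 * Real.pi)) : ℝ) : ℂ) ^ 2) =
        -((℘[ofUpperHalfPlane UpperHalfPlane.I] (((c : GaussianInt) : ℂ) / 7) / ((Real.Gamma (1 / 4) ^ 2 / (2 * Real.sqrt (2 * Real.pi)) : ℝ) : ℂ) ^ 2)) ∧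
        (℘'[ofUpperHalfPlane UpperHalfPlane.I] ((((⟨0, 1⟩ * c) : GaussianInt) : ℂ) / 7) / (2 * ((Real.Gamma (1 / 4) ^ 2 / (2 * Real.sqrt (2 * Real.pi)) : ℝ) : ℂ) ^ 3)) = I *
        (℘'[ofUpperHalfPlane UpperHalfPlane.I] (((c : GaussianInt) : ℂ) / 7) / (2 * ((Real.Gamma (1 / 4) ^ 2 / (2 * Real.sqrt (2 * Real.pi)) : ℝ) : ℂ) ^ 3)) := by
  rw [toComplex_I_mul, show I * ((c : GaussianInt) : ℂ) / 7 = I * (((c : GaussianInt) : ℂ) / 7) by ring,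
    GaussianLattice.weierstrassP_I_mul, GaussianLattice.derivWeierstrassP_I_mul]
  constructor <;> ring

/-- `X_{−c} = X_c`, `Y_{−c} = −Y_c` (`℘` even, `℘′` odd). [folklore] -/
theorem X_Y_neg (c : GaussianInt) : (℘[ofUpperHalfPlane UpperHalfPlane.I] ((((-c) : GaussianInt) : ℂ) / 7) / ((Real.Gamma (1 / 4) ^ 2 / (2 * Real.sqrt (2 * Real.pi)) : ℝ) : ℂ) ^ 2) =
    (℘[ofUpperHalfPlane UpperHalfPlane.I] (((c : GaussianInt) : ℂ) / 7) / ((Real.Gamma (1 / 4) ^ 2 / (2 * Real.sqrt (2 * Real.pi)) : ℝ) : ℂ) ^ 2) ∧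
    (℘'[ofUpperHalfPlane UpperHalfPlane.I] ((((-c) : GaussianInt) : ℂ) / 7) / (2 * ((Real.Gamma (1 / 4) ^ 2 / (2 * Real.sqrt (2 * Real.pi)) : ℝ) : ℂ) ^ 3)) =
    -((℘'[ofUpperHalfPlane UpperHalfPlane.I] (((c : GaussianInt) : ℂ) / 7) / (2 * ((Real.Gamma (1 / 4) ^ 2 / (2 * Real.sqrt (2 * Real.pi)) : ℝ) : ℂ) ^ 3))) := by
  rw [GaussianInt.toComplex_neg, show -((c : GaussianInt) : ℂ) / 7 = -(((c : GaussianInt) : ℂ) / 7) by ring,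
    PeriodPair.weierstrassP_neg, PeriodPair.derivWeierstrassP_neg]
  constructor <;> ring

/-- **`X_c = X_d ↔ c ≡ ±d (mod 7)`** for `7 ∤ c, d` (`℘(u) = ℘(v) ↔ u ≡ ±v (mod Λ)`). [folklore] -/
theorem X_eq_X_iff {c d : GaussianInt} (hc : ¬ (7 : GaussianInt) ∣ c) (hd : ¬ (7 : GaussianInt) ∣ d) :
    (℘[ofUpperHalfPlane UpperHalfPlane.I] (((c : GaussianInt) : ℂ) / 7) / ((Real.Gamma (1 / 4) ^ 2 / (2 * Real.sqrt (2 * Real.pi)) : ℝ) : ℂ) ^ 2) =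
        (℘[ofUpperHalfPlane UpperHalfPlane.I] (((d : GaussianInt) : ℂ) / 7) / ((Real.Gamma (1 / 4) ^ 2 / (2 * Real.sqrt (2 * Real.pi)) : ℝ) : ℂ) ^ 2) ↔ (7 : GaussianInt) ∣ c + d ∨
        (7 : GaussianInt) ∣ c - d := by
  rw [div_left_inj' (pow_ne_zero 2 varpi_ne_zero'),
    weierstrassP_eq_weierstrassP_iff (L := ofUpperHalfPlane UpperHalfPlane.I) (div_seven_notMem hc) (div_seven_notMem hd),
    ← div_seven_mem_lattice_iff, ← div_seven_mem_lattice_iff, map_add, map_sub, add_div, sub_div]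

/-- `X_c ≠ X_d` for `c ≢ ±d (mod 7)`. [folklore] -/
theorem X_ne_X {c d : GaussianInt} (hc : ¬ (7 : GaussianInt) ∣ c) (hd : ¬ (7 : GaussianInt) ∣ d)
    (hs : ¬ (7 : GaussianInt) ∣ c + d) (hm : ¬ (7 : GaussianInt) ∣ c - d) :
        (℘[ofUpperHalfPlane UpperHalfPlane.I] (((c : GaussianInt) : ℂ) / 7) / ((Real.Gamma (1 / 4) ^ 2 / (2 * Real.sqrt (2 * Real.pi)) : ℝ) : ℂ) ^ 2) ≠
        (℘[ofUpperHalfPlane UpperHalfPlane.I] (((d : GaussianInt) : ℂ) / 7) / ((Real.Gamma (1 / 4) ^ 2 / (2 * Real.sqrt (2 * Real.pi)) : ℝ) : ℂ) ^ 2) := fun h ↦ by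
  rcases (X_eq_X_iff hc hd).mp h with h' | h'
  exacts [hs h', hm h']

/-- The division values lie on `Y² = X³ − X` and `ψ₇(X_c) = 0`; `X_c, Y_c ≠ 0` and, for every valuation `v` of `ℂ` with `v 7 < 1`,
`v(X_c⁻¹)²⁴ = v 7`, `v(t_c)⁴⁸ = v 7` (bed-w4 g10). [cite: SilvermanAEC2009, Thm. V.3.1] -/
theorem curve_X_Y {c : GaussianInt} (hc : ¬ (7 : GaussianInt) ∣ c) :
    ((℘'[ofUpperHalfPlane UpperHalfPlane.I] (((c : GaussianInt) : ℂ) / 7) / (2 * ((Real.Gamma (1 / 4) ^ 2 / (2 * Real.sqrt (2 * Real.pi)) : ℝ) : ℂ) ^ 3))) ^ 2 =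
    ((℘[ofUpperHalfPlane UpperHalfPlane.I] (((c : GaussianInt) : ℂ) / 7) / ((Real.Gamma (1 / 4) ^ 2 / (2 * Real.sqrt (2 * Real.pi)) : ℝ) : ℂ) ^ 2)) ^ 3 -
    (℘[ofUpperHalfPlane UpperHalfPlane.I] (((c : GaussianInt) : ℂ) / 7) / ((Real.Gamma (1 / 4) ^ 2 / (2 * Real.sqrt (2 * Real.pi)) : ℝ) : ℂ) ^ 2) :=
  (psi_seven_weierstrassP_div (div_seven_notMem hc) (seven_mul_div_seven_mem c)).2

variable {Γ₀ : Type*} [LinearOrderedCommGroupWithZero Γ₀] (v : Valuation ℂ Γ₀)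

/-- For `7 ∤ c` and `v 7 < 1`: `X_c ≠ 0`, `Y_c ≠ 0`, `v(X_c⁻¹)²⁴ = v 7`, `v(X_c/Y_c)⁴⁸ = v 7`. [cite: SilvermanAEC2009, Thm. V.3.1] -/
theorem val_division (h7 : v 7 < 1) {c : GaussianInt} (hc : ¬ (7 : GaussianInt) ∣ c) :
    (℘[ofUpperHalfPlane UpperHalfPlane.I] (((c : GaussianInt) : ℂ) / 7) / ((Real.Gamma (1 / 4) ^ 2 / (2 * Real.sqrt (2 * Real.pi)) : ℝ) : ℂ) ^ 2) ≠ 0 ∧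
        (℘'[ofUpperHalfPlane UpperHalfPlane.I] (((c : GaussianInt) : ℂ) / 7) / (2 * ((Real.Gamma (1 / 4) ^ 2 / (2 * Real.sqrt (2 * Real.pi)) : ℝ) : ℂ) ^ 3)) ≠ 0 ∧ v
        ((℘[ofUpperHalfPlane UpperHalfPlane.I] (((c : GaussianInt) : ℂ) / 7) / ((Real.Gamma (1 / 4) ^ 2 / (2 * Real.sqrt (2 * Real.pi)) : ℝ) : ℂ) ^ 2))⁻¹ ^ 24 = v 7 ∧ v
        ((℘[ofUpperHalfPlane UpperHalfPlane.I] (((c : GaussianInt) : ℂ) / 7) / ((Real.Gamma (1 / 4) ^ 2 / (2 * Real.sqrt (2 * Real.pi)) : ℝ) : ℂ) ^ 2) /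
        (℘'[ofUpperHalfPlane UpperHalfPlane.I] (((c : GaussianInt) : ℂ) / 7) / (2 * ((Real.Gamma (1 / 4) ^ 2 / (2 * Real.sqrt (2 * Real.pi)) : ℝ) : ℂ) ^ 3))) ^ 48 = v 7 :=
  val_weierstrassP_seven_div v h7 (div_seven_notMem hc) (seven_mul_div_seven_mem c)

/-- **All `t_c` have the same valuation**: `v(t_c) = v(t_d)` (both are `48`-th roots of `v 7`). [cite: Serre1979, Ch. I §6] -/
theorem val_t_eq (h7 : v 7 < 1) {c d : GaussianInt} (hc : ¬ (7 : GaussianInt) ∣ c) (hd : ¬ (7 : GaussianInt) ∣ d) :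
    v ((℘[ofUpperHalfPlane UpperHalfPlane.I] (((c : GaussianInt) : ℂ) / 7) / ((Real.Gamma (1 / 4) ^ 2 / (2 * Real.sqrt (2 * Real.pi)) : ℝ) : ℂ) ^ 2) /
        (℘'[ofUpperHalfPlane UpperHalfPlane.I] (((c : GaussianInt) : ℂ) / 7) / (2 * ((Real.Gamma (1 / 4) ^ 2 / (2 * Real.sqrt (2 * Real.pi)) : ℝ) : ℂ) ^ 3))) = v
        ((℘[ofUpperHalfPlane UpperHalfPlane.I] (((d : GaussianInt) : ℂ) / 7) / ((Real.Gamma (1 / 4) ^ 2 / (2 * Real.sqrt (2 * Real.pi)) : ℝ) : ℂ) ^ 2) /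
        (℘'[ofUpperHalfPlane UpperHalfPlane.I] (((d : GaussianInt) : ℂ) / 7) / (2 * ((Real.Gamma (1 / 4) ^ 2 / (2 * Real.sqrt (2 * Real.pi)) : ℝ) : ℂ) ^ 3))) :=
  pow_left_injective (by norm_num) ((val_division v h7 hc).2.2.2.trans (val_division v h7 hd).2.2.2.symm)

/-- `v(t_c) < 1` and `0 < v(t_c)`. [cite: Serre1979, Ch. I §6] -/
theorem val_t_lt_one (h7 : v 7 < 1) {c : GaussianInt} (hc : ¬ (7 : GaussianInt) ∣ c) :
    0 < v ((℘[ofUpperHalfPlane UpperHalfPlane.I] (((c : GaussianInt) : ℂ) / 7) / ((Real.Gamma (1 / 4) ^ 2 / (2 * Real.sqrt (2 * Real.pi)) : ℝ) : ℂ) ^ 2) /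
        (℘'[ofUpperHalfPlane UpperHalfPlane.I] (((c : GaussianInt) : ℂ) / 7) / (2 * ((Real.Gamma (1 / 4) ^ 2 / (2 * Real.sqrt (2 * Real.pi)) : ℝ) : ℂ) ^ 3))) ∧ v
        ((℘[ofUpperHalfPlane UpperHalfPlane.I] (((c : GaussianInt) : ℂ) / 7) / ((Real.Gamma (1 / 4) ^ 2 / (2 * Real.sqrt (2 * Real.pi)) : ℝ) : ℂ) ^ 2) /
        (℘'[ofUpperHalfPlane UpperHalfPlane.I] (((c : GaussianInt) : ℂ) / 7) / (2 * ((Real.Gamma (1 / 4) ^ 2 / (2 * Real.sqrt (2 * Real.pi)) : ℝ) : ℂ) ^ 3))) < 1 := by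
  obtain ⟨hX0, hY0, -, h48⟩ := val_division v h7 hc
  have hpos : 0 < v ((℘[ofUpperHalfPlane UpperHalfPlane.I] (((c : GaussianInt) : ℂ) / 7) / ((Real.Gamma (1 / 4) ^ 2 / (2 * Real.sqrt (2 * Real.pi)) : ℝ) : ℂ) ^ 2) /
      (℘'[ofUpperHalfPlane UpperHalfPlane.I] (((c : GaussianInt) : ℂ) / 7) / (2 * ((Real.Gamma (1 / 4) ^ 2 / (2 * Real.sqrt (2 * Real.pi)) : ℝ) : ℂ) ^ 3))) :=
    lt_of_le_of_ne zero_le (Ne.symm ((Valuation.ne_zero_iff v).mpr (div_ne_zero hX0 hY0)))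
  refine ⟨hpos, ?_⟩
  by_contra hge
  push Not at hge
  have : (1 : Γ₀) ≤ v ((℘[ofUpperHalfPlane UpperHalfPlane.I] (((c : GaussianInt) : ℂ) / 7) / ((Real.Gamma (1 / 4) ^ 2 / (2 * Real.sqrt (2 * Real.pi)) : ℝ) : ℂ) ^ 2) /
      (℘'[ofUpperHalfPlane UpperHalfPlane.I] (((c : GaussianInt) : ℂ) / 7) / (2 * ((Real.Gamma (1 / 4) ^ 2 / (2 * Real.sqrt (2 * Real.pi)) : ℝ) : ℂ) ^ 3))) ^ 48 := one_le_pow₀ hge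
  rw [h48] at this
  exact absurd h7 (not_lt.mpr this)

/-- **`v(X_c⁻¹) = v(t_c)²` and `v(Y_c⁻¹) = v(t_c)³`** (orders `−1/24`, `−1/16`, `1/48` of `X`, `Y`, `t = X/Y`). [cite: SilvermanAEC2009, IV.1 and VII.2] -/
theorem val_inv_X_Y (h7 : v 7 < 1) {c : GaussianInt} (hc : ¬ (7 : GaussianInt) ∣ c) :
    v ((℘[ofUpperHalfPlane UpperHalfPlane.I] (((c : GaussianInt) : ℂ) / 7) / ((Real.Gamma (1 / 4) ^ 2 / (2 * Real.sqrt (2 * Real.pi)) : ℝ) : ℂ) ^ 2))⁻¹ = v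
        ((℘[ofUpperHalfPlane UpperHalfPlane.I] (((c : GaussianInt) : ℂ) / 7) / ((Real.Gamma (1 / 4) ^ 2 / (2 * Real.sqrt (2 * Real.pi)) : ℝ) : ℂ) ^ 2) /
        (℘'[ofUpperHalfPlane UpperHalfPlane.I] (((c : GaussianInt) : ℂ) / 7) / (2 * ((Real.Gamma (1 / 4) ^ 2 / (2 * Real.sqrt (2 * Real.pi)) : ℝ) : ℂ) ^ 3))) ^ 2 ∧ v
        ((℘'[ofUpperHalfPlane UpperHalfPlane.I] (((c : GaussianInt) : ℂ) / 7) / (2 * ((Real.Gamma (1 / 4) ^ 2 / (2 * Real.sqrt (2 * Real.pi)) : ℝ) : ℂ) ^ 3)))⁻¹ = v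
        ((℘[ofUpperHalfPlane UpperHalfPlane.I] (((c : GaussianInt) : ℂ) / 7) / ((Real.Gamma (1 / 4) ^ 2 / (2 * Real.sqrt (2 * Real.pi)) : ℝ) : ℂ) ^ 2) /
        (℘'[ofUpperHalfPlane UpperHalfPlane.I] (((c : GaussianInt) : ℂ) / 7) / (2 * ((Real.Gamma (1 / 4) ^ 2 / (2 * Real.sqrt (2 * Real.pi)) : ℝ) : ℂ) ^ 3))) ^ 3 := by
  obtain ⟨hX0, hY0, h24, h48⟩ := val_division v h7 hc
  set X : ℂ := (℘[ofUpperHalfPlane UpperHalfPlane.I] (((c : GaussianInt) : ℂ) / 7) / ((Real.Gamma (1 / 4) ^ 2 / (2 * Real.sqrt (2 * Real.pi)) : ℝ) : ℂ) ^ 2) with hXdef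
  set Y : ℂ := (℘'[ofUpperHalfPlane UpperHalfPlane.I] (((c : GaussianInt) : ℂ) / 7) / (2 * ((Real.Gamma (1 / 4) ^ 2 / (2 * Real.sqrt (2 * Real.pi)) : ℝ) : ℂ) ^ 3)) with hYdef
  have hX : v X⁻¹ = v (X / Y) ^ 2 := by
    apply pow_left_injective (by norm_num : (24 : ℕ) ≠ 0)
    dsimp only
    rw [h24, ← pow_mul, h48]
  refine ⟨hX, ?_⟩
  have : Y⁻¹ = (X / Y) * X⁻¹ := by
    rw [div_mul_eq_mul_div, mul_inv_cancel₀ hX0, one_div]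
  rw [this, Valuation.map_mul, hX, ← pow_succ']

/-- **`t_c = t_d → c ≡ d (mod 7)`** (for `7 ∤ c, d`): `X_c/Y_c = X_d/Y_d` forces `X_c = X_d` or `X_cX_d = −1`, the latter impossible
since `v(X_cX_d) > 1`; then `c ≡ ±d`, and `c ≡ −d` would give `t_c = −t_c`. [folklore] -/
theorem dvd_sub_of_t_eq (h7 : v 7 < 1) {c d : GaussianInt} (hc : ¬ (7 : GaussianInt) ∣ c) (hd : ¬ (7 : GaussianInt) ∣ d)
    (h : (℘[ofUpperHalfPlane UpperHalfPlane.I] (((c : GaussianInt) : ℂ) / 7) / ((Real.Gamma (1 / 4) ^ 2 / (2 * Real.sqrt (2 * Real.pi)) : ℝ) : ℂ) ^ 2) /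
        (℘'[ofUpperHalfPlane UpperHalfPlane.I] (((c : GaussianInt) : ℂ) / 7) / (2 * ((Real.Gamma (1 / 4) ^ 2 / (2 * Real.sqrt (2 * Real.pi)) : ℝ) : ℂ) ^ 3)) =
        (℘[ofUpperHalfPlane UpperHalfPlane.I] (((d : GaussianInt) : ℂ) / 7) / ((Real.Gamma (1 / 4) ^ 2 / (2 * Real.sqrt (2 * Real.pi)) : ℝ) : ℂ) ^ 2) /
        (℘'[ofUpperHalfPlane UpperHalfPlane.I] (((d : GaussianInt) : ℂ) / 7) / (2 * ((Real.Gamma (1 / 4) ^ 2 / (2 * Real.sqrt (2 * Real.pi)) : ℝ) : ℂ) ^ 3))) : (7 : GaussianInt) ∣ c - d := by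
  obtain ⟨hXc, hYc, h24c, -⟩ := val_division v h7 hc
  obtain ⟨hXd, hYd, h24d, -⟩ := val_division v h7 hd
  have hcur := curve_X_Y hc
  have hdur := curve_X_Y hd
  -- valuations of `X⁻¹` are `< 1`
  have hlt : ∀ {e : GaussianInt}, ¬ (7 : GaussianInt) ∣ e → v
      ((℘[ofUpperHalfPlane UpperHalfPlane.I] (((e : GaussianInt) : ℂ) / 7) / ((Real.Gamma (1 / 4) ^ 2 / (2 * Real.sqrt (2 * Real.pi)) : ℝ) : ℂ) ^ 2))⁻¹ < 1 := by
    intro e he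
    obtain ⟨-, -, h24e, -⟩ := val_division v h7 he
    by_contra hge
    push Not at hge
    have : (1 : Γ₀) ≤ v ((℘[ofUpperHalfPlane UpperHalfPlane.I] (((e : GaussianInt) : ℂ) / 7) / ((Real.Gamma (1 / 4) ^ 2 / (2 * Real.sqrt (2 * Real.pi)) : ℝ) : ℂ) ^ 2))⁻¹ ^ 24 := one_le_pow₀ hge
    rw [h24e] at this
    exact absurd h7 (not_lt.mpr this)
  have hltc := hlt hc
  have hltd := hlt hd
  set X₁ : ℂ := (℘[ofUpperHalfPlane UpperHalfPlane.I] (((c : GaussianInt) : ℂ) / 7) / ((Real.Gamma (1 / 4) ^ 2 / (2 * Real.sqrt (2 * Real.pi)) : ℝ) : ℂ) ^ 2) with hX₁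
  set Y₁ : ℂ := (℘'[ofUpperHalfPlane UpperHalfPlane.I] (((c : GaussianInt) : ℂ) / 7) / (2 * ((Real.Gamma (1 / 4) ^ 2 / (2 * Real.sqrt (2 * Real.pi)) : ℝ) : ℂ) ^ 3)) with hY₁
  set X₂ : ℂ := (℘[ofUpperHalfPlane UpperHalfPlane.I] (((d : GaussianInt) : ℂ) / 7) / ((Real.Gamma (1 / 4) ^ 2 / (2 * Real.sqrt (2 * Real.pi)) : ℝ) : ℂ) ^ 2) with hX₂
  set Y₂ : ℂ := (℘'[ofUpperHalfPlane UpperHalfPlane.I] (((d : GaussianInt) : ℂ) / 7) / (2 * ((Real.Gamma (1 / 4) ^ 2 / (2 * Real.sqrt (2 * Real.pi)) : ℝ) : ℂ) ^ 3)) with hY₂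
  have h' : X₁ * Y₂ = X₂ * Y₁ := by rwa [div_eq_div_iff hYc hYd] at h
  have h2 : (X₁ * Y₂) ^ 2 = (X₂ * Y₁) ^ 2 := by rw [h']
  -- `X₁ X₂ (X₂ − X₁)(X₁ X₂ + 1) = 0`
  have key : X₁ * X₂ * (X₂ - X₁) * (X₁ * X₂ + 1) = 0 := by
    linear_combination h2 - X₁ ^ 2 * hdur + X₂ ^ 2 * hcur
  have hprod : X₁ * X₂ + 1 ≠ 0 := by
    intro h0
    have hm1 : X₁ * X₂ = -1 := by linear_combination h0
    have hv : v (X₁ * X₂) = 1 := by rw [hm1, Valuation.map_neg, Valuation.map_one]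
    have h1 : v (X₁⁻¹ * X₂⁻¹) < 1 := by
      rw [Valuation.map_mul]
      exact mul_lt_one' hltc hltd
    rw [← mul_inv, map_inv₀, hv, inv_one] at h1
    exact lt_irrefl _ h1
  rcases mul_eq_zero.mp key with h0 | h0
  · rcases mul_eq_zero.mp h0 with h00 | h00
    · rcases mul_eq_zero.mp h00 with h000 | h000
      · exact absurd h000 hXc
      · exact absurd h000 hXd
    · -- `X₁ = X₂`
      have hX : (℘[ofUpperHalfPlane UpperHalfPlane.I] (((c : GaussianInt) : ℂ) / 7) / ((Real.Gamma (1 / 4) ^ 2 / (2 * Real.sqrt (2 * Real.pi)) : ℝ) : ℂ) ^ 2) =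
          (℘[ofUpperHalfPlane UpperHalfPlane.I] (((d : GaussianInt) : ℂ) / 7) / ((Real.Gamma (1 / 4) ^ 2 / (2 * Real.sqrt (2 * Real.pi)) : ℝ) : ℂ) ^ 2) := by linear_combination (-1 : ℂ) * h00
      rcases (X_eq_X_iff hc hd).mp hX with hsum | hdiff
      · -- `c ≡ −d`: then `(X_c, Y_c) = (X_d, −Y_d)`, so `t_c = −t_d = −t_c`, i.e. `t_c = 0`
        exfalso
        have hneg := X_Y_neg d
        have hcd : (7 : GaussianInt) ∣ c - (-d) := by rw [sub_neg_eq_add]; exact hsum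
        obtain ⟨hX', hY'⟩ := X_Y_eq_of_dvd_sub hcd
        rw [hneg.1] at hX'
        rw [hneg.2] at hY'
        have hY1 : Y₁ = -Y₂ := hY'
        have ht0 : X₁ * Y₂ = 0 := by
          have e : X₁ * Y₂ = -(X₁ * Y₂) := by
            calc X₁ * Y₂ = X₂ * Y₁ := h'
              _ = X₁ * (-Y₂) := by rw [← hY1, ← show X₁ = X₂ from hX]
              _ = -(X₁ * Y₂) := by ring
          linear_combination e / 2
        rcases mul_eq_zero.mp ht0 with h0' | h0'
        · exact hXc h0'
        · exact hYd h0'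
      · exact hdiff
  · exact absurd h0 hprod

end DivisionValues

end Summit.BirchSwinnertonDyer.BirchSwinnertonDyer.Theorems.BiquadraticEisensteinDescentManinDatumSupercuspidalCMInertSevenDivisionPoints

end
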